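import Mathlib
import Summits.MatrixMultiplication.MatrixMultiplication.Theses.CondensationDistance
import Summits.MatrixMultiplication.MatrixMultiplication.Theorems.CondensationSound.Negative.FanInStep
import Literature.Computability.AlgebraicComplexity.DeterminantIrreducible

/-!
# `CondensationDistance.CondensationSound` (stmt-MatrixMultiplication-15939) — Negative lane, III-b:
# the fan-in bound for division SLPs; the radius-1 ball cannot be widened to radius 2

Crux (route `CondensationDistance`, rank 5, soundness bridge): every valid octahedral Plücker
derivation of length `l` from the RADIUS-1 ball `{|J| = n, #(J ∩ [n, n+m')) ≤ 1}` (the entries of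
`Z` and `1`) listing `[n, 2n)` yields `Derivable ℂ (5 * l) (entries of Z) {det X}`.

Tool (`support_bound`, from the one-step invariant `inv_step` of `FanInStep.lean` iterated along
the sequence, `inv_seq`): an element derivable from the indeterminates in `s` Ω-steps is `p/q` with
`p, q` free of all but at most `s + 1` variables.  Hence (`not_derivable_det_fanin`) `det Xₙ` is not
derivable from its `n²` entries in `s` steps when `s + 2 ≤ n²` (every entry occurs in `det Xₙ`:
tree `degreeOf_detPoly`) — sharper than the degree bound of `DegreeBound.lean` for small `n`.

Consequence for the crux (crux disprover, cycle 1, `Cruxes/CondensationSound/Disproof.lean` §(c);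
the crux itself is true as typed): `condensationSound_false_radius_two` — the strengthening of
the crux in which the radius-2 ball (all `2 × 2` minors free as well) replaces the radius-1 ball
is FALSE (`n = m' = 3`, `l = 1`: the target `{3,4,5}` is one octahedron step above the radius-2
ball, and `det X₃` needs `≥ 8 > 5` steps).  So the input set of the crux (entries only) and its
ball (radius 1) are matched exactly; a proof must use that ball values are entries or `1`.
-/

set_option linter.dupNamespace false

noncomputable section

open scoped Classical
open MvPolynomial Literature.Computability.AlgebraicComplexity

namespace Summit.MatrixMultiplication.MatrixMultiplication.Theorems

namespace CondensationSoundNeg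

variable {σ : Type*}

/-- **The fan-in invariant along a computation sequence** of length `k`: `E` grows by at most
`k`. [folklore] -/
theorem inv_seq : ∀ (l : List (FractionRing (MvPolynomial σ ℂ)))
    (A' : Set (FractionRing (MvPolynomial σ ℂ))) (E : Finset (FractionRing (MvPolynomial σ ℂ)))
    (V : FractionRing (MvPolynomial σ ℂ) → Finset σ)
    (anc : FractionRing (MvPolynomial σ ℂ) → Finset (FractionRing (MvPolynomial σ ℂ))),
    ((∀ x ∈ A', (∃ p q : MvPolynomial σ ℂ, q ≠ 0 ∧
      algebraMap (MvPolynomial σ ℂ) (FractionRing (MvPolynomial σ ℂ)) q * x =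
        algebraMap (MvPolynomial σ ℂ) (FractionRing (MvPolynomial σ ℂ)) p ∧
      ∀ w, w ∉ (V x) → degreeOf w p = 0 ∧ degreeOf w q = 0)) ∧
    (∀ x ∈ A', anc x ⊆ E) ∧ ((↑E : Set (FractionRing (MvPolynomial σ ℂ))) ⊆ A') ∧
    ∀ X : Finset (FractionRing (MvPolynomial σ ℂ)), (↑X : Set (FractionRing (MvPolynomial σ ℂ))) ⊆ A' →
      (X.biUnion V).card ≤ (X.biUnion anc).card + X.card) →
    DivSeq ℂ A' l →
    ∃ (E' : Finset (FractionRing (MvPolynomial σ ℂ))) (V' : FractionRing (MvPolynomial σ ℂ) → Finset σ)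
      (anc' : FractionRing (MvPolynomial σ ℂ) → Finset (FractionRing (MvPolynomial σ ℂ))),
      ((∀ x ∈ (A' ∪ {x | x ∈ l}), (∃ p q : MvPolynomial σ ℂ, q ≠ 0 ∧
      algebraMap (MvPolynomial σ ℂ) (FractionRing (MvPolynomial σ ℂ)) q * x =
        algebraMap (MvPolynomial σ ℂ) (FractionRing (MvPolynomial σ ℂ)) p ∧
      ∀ w, w ∉ (V' x) → degreeOf w p = 0 ∧ degreeOf w q = 0)) ∧
    (∀ x ∈ (A' ∪ {x | x ∈ l}), anc' x ⊆ E') ∧ ((↑E' : Set (FractionRing (MvPolynomial σ ℂ))) ⊆ (A' ∪ {x | x ∈ l})) ∧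
    ∀ X : Finset (FractionRing (MvPolynomial σ ℂ)), (↑X : Set (FractionRing (MvPolynomial σ ℂ))) ⊆ (A' ∪ {x | x ∈ l}) →
      (X.biUnion V').card ≤ (X.biUnion anc').card + X.card) ∧
      E'.card ≤ E.card + l.length
  | [], A', E, V, anc, hI, _ => ⟨E, V, anc, by simpa using hI, by simp⟩
  | v :: l, A', E, V, anc, hI, hl => by
      rw [divSeq_cons] at hl
      obtain ⟨E₁, V₁, anc₁, hI₁, hc₁⟩ := inv_step hI hl.1
      obtain ⟨E₂, V₂, anc₂, hI₂, hc₂⟩ := inv_seq l (insert v A') E₁ V₁ anc₁ hI₁ hl.2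
      refine ⟨E₂, V₂, anc₂, ?_, by simp only [List.length_cons]; omega⟩
      have : insert v A' ∪ {x | x ∈ l} = A' ∪ {x | x ∈ v :: l} := by
        ext x; simp [or_comm, or_assoc, or_left_comm]
      rwa [this] at hI₂

/-- **FAN-IN BOUND for division straight-line programs** (tree model `Derivable`): an element
of `ℂ(σ)` derivable in `s` Ω-steps from the indeterminates is `p/q` with `q ≠ 0` and `p, q` free
of all but at most `s + 1` variables — a fan-in-2 program of length `s` whose last entry is the
output reads at most `s + 1` inputs (BCS 1997, Chap. 4: a computation sequence of length `s` has
`2s` operand slots, at least `s − 1` of which hold earlier results). [folklore] -/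
theorem support_bound [Fintype σ] {s : ℕ} {t : FractionRing (MvPolynomial σ ℂ)}
    (h : Derivable ℂ s
      (Set.range fun v : σ => algebraMap (MvPolynomial σ ℂ) (FractionRing (MvPolynomial σ ℂ)) (X v))
      {t}) :
    ∃ W : Finset σ, W.card ≤ s + 1 ∧
      (∃ p q : MvPolynomial σ ℂ, q ≠ 0 ∧
      algebraMap (MvPolynomial σ ℂ) (FractionRing (MvPolynomial σ ℂ)) q * t =
        algebraMap (MvPolynomial σ ℂ) (FractionRing (MvPolynomial σ ℂ)) p ∧
      ∀ w, w ∉ W → degreeOf w p = 0 ∧ degreeOf w q = 0) := by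
  set A : Set (FractionRing (MvPolynomial σ ℂ)) :=
    Set.range fun v : σ => algebraMap (MvPolynomial σ ℂ) (FractionRing (MvPolynomial σ ℂ)) (X v)
    with hA
  set ιR := algebraMap (MvPolynomial σ ℂ) (FractionRing (MvPolynomial σ ℂ)) with hιR
  -- base invariant on the inputs
  set V₀ : FractionRing (MvPolynomial σ ℂ) → Finset σ := fun x =>
    Finset.univ.filter fun v => ιR (X v) = x with hV₀
  have hinjX : ∀ u w : σ, ιR (X u) = ιR (X w) → u = w := fun u w h =>
    X_injective (IsFractionRing.injective (MvPolynomial σ ℂ) (FractionRing (MvPolynomial σ ℂ)) h)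
  have hV₀X : ∀ u : σ, V₀ (ιR (X u)) = {u} := fun u => by
    ext w
    simp only [hV₀, Finset.mem_filter, Finset.mem_univ, true_and, Finset.mem_singleton]
    exact ⟨fun h => hinjX _ _ h, fun h => by rw [h]⟩
  have hI₀ : ((∀ x ∈ A, (∃ p q : MvPolynomial σ ℂ, q ≠ 0 ∧
        algebraMap (MvPolynomial σ ℂ) (FractionRing (MvPolynomial σ ℂ)) q * x =
          algebraMap (MvPolynomial σ ℂ) (FractionRing (MvPolynomial σ ℂ)) p ∧
        ∀ w, w ∉ (V₀ x) → degreeOf w p = 0 ∧ degreeOf w q = 0)) ∧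
      (∀ x ∈ A, (fun _ => (∅ : Finset (FractionRing (MvPolynomial σ ℂ)))) x ⊆ (∅ : Finset (FractionRing (MvPolynomial σ ℂ)))) ∧ ((↑(∅ : Finset (FractionRing (MvPolynomial σ ℂ))) : Set (FractionRing (MvPolynomial σ ℂ))) ⊆ A) ∧
      ∀ X : Finset (FractionRing (MvPolynomial σ ℂ)), (↑X : Set (FractionRing (MvPolynomial σ ℂ))) ⊆ A →
        (X.biUnion V₀).card ≤ (X.biUnion (fun _ => (∅ : Finset (FractionRing (MvPolynomial σ ℂ))))).card + X.card) := by
    refine ⟨?_, fun _ _ => Finset.Subset.refl _, by simp, ?_⟩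
    · rintro x ⟨u, rfl⟩
      rw [show V₀ (algebraMap (MvPolynomial σ ℂ) (FractionRing (MvPolynomial σ ℂ)) (X u)) = {u}
        from hV₀X u]
      exact suppRep_X u
    · intro T hT
      have h1 : (T.biUnion V₀).card ≤ ∑ x ∈ T, (V₀ x).card := Finset.card_biUnion_le
      have h2 : ∀ x ∈ T, (V₀ x).card = 1 := by
        intro x hx
        obtain ⟨u, rfl⟩ := hT hx
        show (V₀ (ιR (X u))).card = 1
        rw [hV₀X]; rfl
      rw [Finset.sum_congr rfl h2] at h1
      have h3 : (T.biUnion fun _ => (∅ : Finset (FractionRing (MvPolynomial σ ℂ)))) = ∅ := by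
        ext y; simp
      rw [h3, Finset.card_empty, zero_add]
      simpa using h1
  obtain ⟨l, hl, hlen, hsub⟩ := h
  obtain ⟨E', V', anc', hI', hc'⟩ := inv_seq l A ∅ V₀ (fun _ => ∅) hI₀ hl
  have ht := hsub (Set.mem_singleton t)
  rcases ht with (ht | ⟨c, rfl⟩) | ht
  · -- an input
    obtain ⟨u, rfl⟩ := ht
    exact ⟨{u}, by simp, suppRep_X u⟩
  · exact ⟨∅, by simp, suppRep_const ∅ c⟩
  · have htA : t ∈ A ∪ {x | x ∈ l} := Or.inr ht
    obtain ⟨hR, hAnc, hE, hCnt⟩ := hI'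
    refine ⟨V' t, ?_, hR t htA⟩
    have := hCnt {t} (by simpa using htA)
    rw [Finset.singleton_biUnion, Finset.singleton_biUnion, Finset.card_singleton] at this
    have h2 : (anc' t).card ≤ E'.card := Finset.card_le_card (hAnc t htA)
    simp only [Finset.card_empty, zero_add] at hc'
    omega

/-- `det Xₙ` (the crux's `X` at `m' = n`) involves every variable with degree `1`
(tree: `degreeOf_detPoly`). [folklore] -/
theorem degreeOf_det_generic (n : ℕ) (w : Fin n × Fin n) :
    degreeOf w (Matrix.det (Matrix.of fun i j : Fin n =>
      (MvPolynomial.X (i, Fin.castLE (le_refl n) j) : MvPolynomial (Fin n × Fin n) ℂ))) = 1 := by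
  have hM : (Matrix.of fun i j : Fin n =>
      (MvPolynomial.X (i, Fin.castLE (le_refl n) j) : MvPolynomial (Fin n × Fin n) ℂ)) =
      Matrix.mvPolynomialX (Fin n) (Fin n) ℂ := by
    ext i j : 1
    simp
  rw [hM]
  exact degreeOf_detPoly ℂ w

/-- **No division SLP of `s` steps computes `det Xₙ` from the entries when `s + 2 ≤ n²`**
(sharper than the degree bound `2^s < n` of `DegreeBound.lean` for small `n`: `det X₃` needs
`≥ 8` steps): by `support_bound` some entry `w` is missing from `p, q`, but
`deg_w (q · det Xₙ) = deg_w q + deg_w det Xₙ = 0 + 1 ≠ 0 = deg_w p`. [folklore] -/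
theorem not_derivable_det_fanin {n s : ℕ} (hn : s + 2 ≤ n * n) :
    ¬ Derivable ℂ s
      (Set.range fun p : Fin n × Fin n =>
        algebraMap (MvPolynomial (Fin n × Fin n) ℂ) (FractionRing (MvPolynomial (Fin n × Fin n) ℂ))
          (MvPolynomial.X p))
      {algebraMap (MvPolynomial (Fin n × Fin n) ℂ) (FractionRing (MvPolynomial (Fin n × Fin n) ℂ))
        (Matrix.det (Matrix.of fun i j : Fin n => MvPolynomial.X (i, Fin.castLE (le_refl n) j)))} := by
  intro hD
  obtain ⟨W, hW, p, q, hq, e, hz⟩ := support_bound hD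
  have hcard : W.card < (Finset.univ : Finset (Fin n × Fin n)).card := by
    rw [Finset.card_univ, Fintype.card_prod, Fintype.card_fin]; omega
  obtain ⟨w, -, hw⟩ := Finset.exists_mem_notMem_of_card_lt_card hcard
  obtain ⟨hp, hq0⟩ := hz w hw
  rw [← map_mul] at e
  have e' := IsFractionRing.injective (MvPolynomial (Fin n × Fin n) ℂ)
    (FractionRing (MvPolynomial (Fin n × Fin n) ℂ)) e
  have hdet := degreeOf_det_generic n w
  have hdet0 : Matrix.det (Matrix.of fun i j : Fin n =>
      (MvPolynomial.X (i, Fin.castLE (le_refl n) j) : MvPolynomial (Fin n × Fin n) ℂ)) ≠ 0 := by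
    intro h0
    rw [h0, degreeOf_zero] at hdet
    exact zero_ne_one hdet
  have := congrArg (degreeOf w) e'
  rw [degreeOf_mul_eq hq hdet0, hdet, hq0, hp] at this
  omega

/-- **The radius-1 ball cannot be widened: the natural strengthening of `CondensationSound` with
the radius-2 ball** (`#(J ∩ [n, n+m')) ≤ 2`, i.e. all `2 × 2` minors free as well; everything
else verbatim) **is FALSE.**  Witness `n = m' = 3`, `l = 1`, `f 0 = {3,4,5}` (the target): with
`p = 3, q = 4, u = 0, v = 1` its five mates `{0,4,5}, {1,4,5}, {0,3,5}, {1,3,5}, {0,1,5}` have at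
most two elements `≥ 3`, so the one-step derivation is valid for the radius-2 rule (`decide`), while
`det X₃` is not derivable from the nine entries in `5` steps (`not_derivable_det_fanin`,
`5 + 2 ≤ 9`). [folklore] -/
theorem condensationSound_false_radius_two :
    ¬ ∀ (n m' : ℕ) (h : n ≤ m') (l : ℕ) (f : Fin l → Finset (Fin (n + m'))),
      (∀ i : Fin l, ∃ p ∈ f i, ∃ q ∈ f i, p ≠ q ∧ ∃ u ∉ f i, ∃ v ∉ f i, u ≠ v ∧
        ∀ J ∈ [insert u ((f i).erase p), insert v ((f i).erase p), insert u ((f i).erase q),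
          insert v ((f i).erase q), insert u (insert v (((f i).erase p).erase q))],
          (J.card = n ∧ (J.filter fun x : Fin (n + m') => n ≤ x.val).card ≤ 2) ∨
            ∃ j : Fin l, j < i ∧ f j = J) →
      (∃ i : Fin l, f i = Finset.univ.filter fun x : Fin (n + m') => n ≤ x.val ∧ x.val < 2 * n) →
      Literature.Computability.AlgebraicComplexity.Derivable ℂ (5 * l)
        (Set.range fun p : Fin n × Fin m' =>
          algebraMap (MvPolynomial (Fin n × Fin m') ℂ) (FractionRing (MvPolynomial (Fin n × Fin m') ℂ))
            (MvPolynomial.X p))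
        {algebraMap (MvPolynomial (Fin n × Fin m') ℂ) (FractionRing (MvPolynomial (Fin n × Fin m') ℂ))
          (Matrix.det (Matrix.of fun i j : Fin n => MvPolynomial.X (i, Fin.castLE h j)))} := by
  intro H
  refine not_derivable_det_fanin (n := 3) (s := 5) (by norm_num) (H 3 3 le_rfl 1
    (fun _ => Finset.univ.filter fun x : Fin (3 + 3) => 3 ≤ x.val ∧ x.val < 2 * 3) ?_ ⟨0, rfl⟩)
  intro i
  obtain rfl : i = 0 := Subsingleton.elim _ _
  refine ⟨⟨3, by norm_num⟩, by decide, ⟨4, by norm_num⟩, by decide, by decide,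
    ⟨0, by norm_num⟩, by decide, ⟨1, by norm_num⟩, by decide, by decide, ?_⟩
  decide


end CondensationSoundNeg

end Summit.MatrixMultiplication.MatrixMultiplication.Theorems

end
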